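import Summits.Ventures.HodgeRepro2.T5HeckeInduced
import Summits.Ventures.HodgeRepro2.T5SmoothDualIrreducible

/-!
# Every simple `H(G, K)`-module is `π^K` for an irreducible `π`

Let `M` be a simple (right) `H(G, K)`-module (`IsSimpleOrder (Submodule H(G, K)ᵐᵒᵖ M)`, the
content of Mathlib's `IsSimpleModule`) and `X := M ⊗_{H(G, K)} k[G/K]` the representation of
`T5HeckeInduced` (char 0, every double coset `KgK/K` finite).  Let `X_max ⊆ X` be the subspace of
the `x` all of whose translates have `e_K(gx) = 0` — the largest subrepresentation without `K`-fixed
vectors.  Then `π := X / X_max` is IRREDUCIBLE (`isIrreducible_quotRep`), `K`-finite, and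
`π^K ≅ M` as `H(G, K)`-modules (`quotInvariantsEquiv`, `heckeSMul_quotInvariantsEquiv`): the
SURJECTIVITY half of the printed bijection «irreducible `π` with `π^K ≠ 0` ↔ simple
`H(G, K)`-modules» (Bushnell–Henniart §4.3, Bernstein); the injectivity half is
`T5HeckeInvariantsDetermine`.

Proof of irreducibility: a subrepresentation `N ⊆ X` not contained in `X_max` has a non-zero
`K`-fixed vector `e_K(gn)`; the `K`-fixed vectors of `N` form an `H(G, K)`-submodule of `X^K ≅ M`,
hence all of `X^K` by simplicity; so `N ⊇ [M ⊗ δ_K]`, which generates `X`.  Thus `X_max` is the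
unique maximal subrepresentation and `X / X_max` is irreducible; its `K`-invariants are
`X^K / (X_max)^K = X^K` by the exactness of `V ↦ V^K` (`T5LevelIdempotentNaturality`).
-/

namespace Summit.Ventures.HodgeRepro2.T5HeckeInducedIrreducible

open T5HeckePermutationModule T5HeckeSimpleInvariants T5LevelIdempotent T5LevelIdempotentDual
  T5LevelIdempotentNaturality T5HeckeInduced LevelPositivity

variable {G : Type*} [Group G] {k : Type*} [Field k]

section QuotientRep

variable {V : Type*} [AddCommGroup V] [Module k V] (ρ : Representation k G V)

/-- A `G`-stable submodule gives a quotient representation. -/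
noncomputable def quotientBySub (N : Submodule k V) (hN : ∀ (g : G) ⦃v : V⦄, v ∈ N → ρ g v ∈ N) :
    Representation k G (V ⧸ N) where
  toFun g := N.mapQ N (ρ g) (fun v hv => hN g hv)
  map_one' := by
    apply LinearMap.ext
    intro x
    induction x using Submodule.Quotient.induction_on with
    | H z => rw [Submodule.mapQ_apply, map_one, Module.End.one_apply, Module.End.one_apply]
  map_mul' g h := by
    apply LinearMap.ext
    intro x
    induction x using Submodule.Quotient.induction_on with
    | H z =>
      rw [Submodule.mapQ_apply, map_mul, Module.End.mul_apply, Module.End.mul_apply,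
        Submodule.mapQ_apply, Submodule.mapQ_apply]

/-- The quotient action on classes. -/
theorem quotientRep_mk (N : Submodule k V) (hN : ∀ (g : G) ⦃v : V⦄, v ∈ N → ρ g v ∈ N) (g : G)
    (v : V) : quotientBySub ρ N hN g (Submodule.Quotient.mk v) = Submodule.Quotient.mk (ρ g v) :=
  Submodule.mapQ_apply N N (ρ g) (h := fun _ hv => hN g hv) v

/-- The projection `V → V ⧸ N` is equivariant. -/
theorem mkQ_equivariant (N : Submodule k V) (hN : ∀ (g : G) ⦃v : V⦄, v ∈ N → ρ g v ∈ N) (g : G)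
    (v : V) : N.mkQ (ρ g v) = quotientBySub ρ N hN g (N.mkQ v) := by
  rw [Submodule.mkQ_apply, Submodule.mkQ_apply, quotientRep_mk]

/-- `K`-finiteness passes to quotients. -/
theorem kFinite_quotientRep {K : Subgroup G} (hK : KFinite ρ K) (N : Submodule k V)
    (hN : ∀ (g : G) ⦃v : V⦄, v ∈ N → ρ g v ∈ N) : KFinite (quotientBySub ρ N hN) K := by
  intro x
  induction x using Submodule.Quotient.induction_on with
  | H v =>
    haveI := hK v
    refine Subgroup.finiteIndex_of_le (H := stabilizerIn ρ K v) ?_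
    intro κ hκ
    rw [mem_stabilizerIn_iff] at hκ ⊢
    rw [quotientRep_mk, hκ]

/-- The Frobenius map of a vector of a `G`-stable submodule lands in that submodule. -/
theorem orbitLinear_mem {K : Subgroup G} (N : Submodule k V)
    (hN : ∀ (g : G) ⦃v : V⦄, v ∈ N → ρ g v ∈ N) {v : V} (hv : v ∈ invariants ρ K) (hvN : v ∈ N)
    (f : MonoidAlgebra k (G ⧸ K)) : orbitLinear ρ v hv f ∈ N := by
  rw [show f = f.coeff.sum (fun x c => MonoidAlgebra.single x c) from
    (MonoidAlgebra.sum_coeff_single f).symm, map_finsuppSum]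
  refine Submodule.finsuppSum_mem _ _ _ _ fun x _ => ?_
  rw [orbitLinear_single]
  refine Submodule.smul_mem _ _ ?_
  induction x using QuotientGroup.induction_on with
  | H g =>
    rw [orbitMap_mk]
    exact hN g hvN

/-- The `K`-fixed vectors of a `G`-stable submodule are Hecke-stable. -/
theorem heckeSMul_mem {K : Subgroup G} (N : Submodule k V)
    (hN : ∀ (g : G) ⦃v : V⦄, v ∈ N → ρ g v ∈ N) (T : heckeAlgebra k K) {v : invariants ρ K}
    (hvN : (v : V) ∈ N) : (heckeSMul ρ T v : V) ∈ N := by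
  rw [heckeSMul_coe]
  exact orbitLinear_mem ρ N hN v.2 hvN _

end QuotientRep

section HeckeSub

variable (k) (K : Subgroup G) (M : Type*) [AddCommGroup M] [Module k M]
  [Module (heckeAlgebra k K)ᵐᵒᵖ M] [IsScalarTower k (heckeAlgebra k K)ᵐᵒᵖ M]

/-- The `H(G, K)`-submodule of `M` cut out by a `G`-stable subspace `N ⊆ X`: the `m` with
`[m ⊗ δ_K] ∈ N`. -/
noncomputable def heckeSubOf (N : Submodule k (Induced k K M))
    (hN : ∀ (g : G) ⦃x : Induced k K M⦄, x ∈ N → inducedRep k K M g x ∈ N) :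
    Submodule (heckeAlgebra k K)ᵐᵒᵖ M where
  carrier := {m | toInduced k K M m ∈ N}
  add_mem' {a b} ha hb := by
    simp only [Set.mem_setOf_eq] at ha hb ⊢
    rw [map_add]
    exact N.add_mem ha hb
  zero_mem' := by
    simp only [Set.mem_setOf_eq, map_zero]
    exact N.zero_mem
  smul_mem' T m hm := by
    simp only [Set.mem_setOf_eq] at hm ⊢
    induction T using MulOpposite.rec' with
    | h T =>
      rw [← heckeSMul_toInduced]
      exact heckeSMul_mem (inducedRep k K M) N hN T hm

omit [IsScalarTower k (heckeAlgebra k K)ᵐᵒᵖ M] in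
/-- Membership in `heckeSubOf`. -/
theorem mem_heckeSubOf_iff (N : Submodule k (Induced k K M))
    (hN : ∀ (g : G) ⦃x : Induced k K M⦄, x ∈ N → inducedRep k K M g x ∈ N) (m : M) :
    m ∈ heckeSubOf k K M N hN ↔ toInduced k K M m ∈ N := Iff.rfl

end HeckeSub

section Main

variable (k) (K : Subgroup G) (M : Type*) [AddCommGroup M] [Module k M]
  [Module (heckeAlgebra k K)ᵐᵒᵖ M] [IsScalarTower k (heckeAlgebra k K)ᵐᵒᵖ M]
  (hfin : ∀ g : G, Finite (MulAction.orbit K (g : G ⧸ K))) [CharZero k]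

include hfin

/-- THE MAXIMAL SUBREPRESENTATION WITHOUT `K`-FIXED VECTORS: the `x ∈ X` with `e_K(gx) = 0` for
every `g`. -/
noncomputable def maxSub : Submodule k (Induced k K M) :=
  ⨅ g : G, LinearMap.ker ((levelIdempotentTo (inducedRep k K M) (kFinite_inducedRep k K M hfin)) ∘ₗ
    inducedRep k K M g)

omit [IsScalarTower k (heckeAlgebra k K)ᵐᵒᵖ M] in
/-- Membership in `X_max`. -/
theorem mem_maxSub_iff (x : Induced k K M) :
    x ∈ maxSub k K M hfin ↔
      ∀ g : G, levelIdempotentTo (inducedRep k K M) (kFinite_inducedRep k K M hfin)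
        (inducedRep k K M g x) = 0 := by
  unfold maxSub
  simp only [Submodule.mem_iInf, LinearMap.mem_ker, LinearMap.comp_apply]

omit [IsScalarTower k (heckeAlgebra k K)ᵐᵒᵖ M] in
/-- `X_max` is `G`-stable. -/
theorem maxSub_stable (g : G) ⦃x : Induced k K M⦄ (hx : x ∈ maxSub k K M hfin) :
    inducedRep k K M g x ∈ maxSub k K M hfin := by
  rw [mem_maxSub_iff] at hx ⊢
  intro h
  rw [← Module.End.mul_apply, ← map_mul]
  exact hx (h * g)

omit [IsScalarTower k (heckeAlgebra k K)ᵐᵒᵖ M] in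
/-- A `K`-fixed vector of `X_max` is zero. -/
theorem eq_zero_of_mem_maxSub_of_mem_invariants {x : Induced k K M} (hx : x ∈ maxSub k K M hfin)
    (hxK : x ∈ invariants (inducedRep k K M) K) : x = 0 := by
  rw [mem_maxSub_iff] at hx
  have h := hx 1
  rw [map_one, Module.End.one_apply] at h
  have h' := congrArg Subtype.val h
  rw [levelIdempotentTo_apply, levelAverage_of_mem_invariants hxK, Submodule.coe_zero] at h'
  exact h'

/-- `[m ⊗ δ_K] ∉ X_max` for `m ≠ 0`. -/
theorem toInduced_notMem_maxSub {m : M} (hm : m ≠ 0) : toInduced k K M m ∉ maxSub k K M hfin := by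
  intro h
  apply hm
  apply toInduced_injective k K M hfin
  rw [map_zero]
  exact eq_zero_of_mem_maxSub_of_mem_invariants k K M hfin h (toInduced_mem_invariants k K M m)

omit [IsScalarTower k (heckeAlgebra k K)ᵐᵒᵖ M] in
/-- A `G`-stable subspace of `X` not contained in `X_max` contains a non-zero `K`-fixed vector. -/
theorem exists_mem_invariants_of_not_le {N : Submodule k (Induced k K M)}
    (hN : ∀ (g : G) ⦃x : Induced k K M⦄, x ∈ N → inducedRep k K M g x ∈ N)
    (hle : ¬ N ≤ maxSub k K M hfin) :
    ∃ x : Induced k K M, x ∈ N ∧ x ∈ invariants (inducedRep k K M) K ∧ x ≠ 0 := by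
  rw [SetLike.le_def] at hle
  push Not at hle
  obtain ⟨n, hnN, hn⟩ := hle
  rw [mem_maxSub_iff] at hn
  push Not at hn
  obtain ⟨g, hg⟩ := hn
  refine ⟨(levelIdempotentTo (inducedRep k K M) (kFinite_inducedRep k K M hfin)
    (inducedRep k K M g n) : Induced k K M), ?_,
    (levelIdempotentTo (inducedRep k K M) (kFinite_inducedRep k K M hfin) (inducedRep k K M g n)).2,
    ?_⟩
  · rw [levelIdempotentTo_apply]
    haveI := kFinite_inducedRep k K M hfin (inducedRep k K M g n)
    exact T5SmoothDualIrreducible.levelAverage_mem_of_mem (inducedRep k K M) ⟨N, hN⟩ (hN g hnN)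
  · intro h0
    apply hg
    apply Subtype.ext
    rw [Submodule.coe_zero]
    exact h0

omit [IsScalarTower k (heckeAlgebra k K)ᵐᵒᵖ M] in
/-- A `G`-stable subspace of `X` not contained in `X_max` is everything, when `M` is simple. -/
theorem eq_top_of_not_le [IsSimpleOrder (Submodule (heckeAlgebra k K)ᵐᵒᵖ M)]
    {N : Submodule k (Induced k K M)}
    (hN : ∀ (g : G) ⦃x : Induced k K M⦄, x ∈ N → inducedRep k K M g x ∈ N)
    (hle : ¬ N ≤ maxSub k K M hfin) : N = ⊤ := by
  obtain ⟨x, hxN, hxK, hx0⟩ := exists_mem_invariants_of_not_le k K M hfin hN hle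
  obtain ⟨m, rfl⟩ := exists_toInduced_eq k K M hfin hxK
  have hm : m ≠ 0 := by
    rintro rfl
    exact hx0 (map_zero _)
  have hP : heckeSubOf k K M N hN = ⊤ := by
    rcases eq_bot_or_eq_top (heckeSubOf k K M N hN) with h | h
    · exfalso
      have : m ∈ heckeSubOf k K M N hN := hxN
      rw [h, Submodule.mem_bot] at this
      exact hm this
    · exact h
  -- every `[m' ⊗ δ_K]` lies in `N`, hence the `G`-span of them, hence everything
  have hall : ∀ m' : M, toInduced k K M m' ∈ N := by
    intro m'
    have : m' ∈ heckeSubOf k K M N hN := by rw [hP]; exact Submodule.mem_top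
    exact this
  rw [eq_top_iff]
  intro x hx
  clear hx
  induction x using Submodule.Quotient.induction_on with
  | H z =>
    induction z using TensorProduct.induction_on with
    | zero =>
      rw [Submodule.Quotient.mk_zero]
      exact N.zero_mem
    | tmul m' f =>
      have hspan := mk_tmul_mem_gSpan k K M m' f
      rw [gSpan] at hspan
      refine Submodule.span_le.2 ?_ hspan
      rintro _ ⟨g, v, hv, rfl⟩
      apply hN g
      rw [LinearMap.mem_range] at hv
      obtain ⟨m'', hm''⟩ := hv
      have : (v : Induced k K M) = toInduced k K M m'' := by rw [← hm'']; rfl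
      rw [this]
      exact hall m''
    | add x y hx hy =>
      rw [Submodule.Quotient.mk_add]
      exact N.add_mem hx hy

/-- THE IRREDUCIBLE QUOTIENT `π := X / X_max`. -/
noncomputable abbrev quotRep : Representation k G (Induced k K M ⧸ maxSub k K M hfin) :=
  quotientBySub (inducedRep k K M) (maxSub k K M hfin) (maxSub_stable k K M hfin)

omit [IsScalarTower k (heckeAlgebra k K)ᵐᵒᵖ M] in
/-- `π` is `K`-finite. -/
theorem kFinite_quotRep : KFinite (quotRep k K M hfin) K :=
  kFinite_quotientRep _ (kFinite_inducedRep k K M hfin) _ _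

/-- `π ≠ 0` when `M ≠ 0`. -/
theorem nontrivial_quot [Nontrivial M] : Nontrivial (Induced k K M ⧸ maxSub k K M hfin) := by
  obtain ⟨m, hm⟩ := exists_ne (0 : M)
  refine ⟨⟨Submodule.Quotient.mk (toInduced k K M m), 0, ?_⟩⟩
  rw [Ne, Submodule.Quotient.mk_eq_zero]
  exact toInduced_notMem_maxSub k K M hfin hm

/-- `π = X / X_max` IS IRREDUCIBLE when `M` is a simple `H(G, K)`-module. -/
theorem isIrreducible_quotRep [IsSimpleOrder (Submodule (heckeAlgebra k K)ᵐᵒᵖ M)] :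
    (quotRep k K M hfin).IsIrreducible := by
  haveI : Nontrivial M := (Submodule.nontrivial_iff (heckeAlgebra k K)ᵐᵒᵖ).1 inferInstance
  haveI := nontrivial_quot k K M hfin
  haveI : Nontrivial (Subrepresentation (quotRep k K M hfin)) := by
    refine ⟨⟨⊥, ⊤, fun h => ?_⟩⟩
    obtain ⟨q, hq⟩ := exists_ne (0 : Induced k K M ⧸ maxSub k K M hfin)
    have hq' : q ∈ (⊥ : Submodule k (Induced k K M ⧸ maxSub k K M hfin)) := by
      rw [show (⊥ : Submodule k (Induced k K M ⧸ maxSub k K M hfin)) = ⊤ from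
        congrArg Subrepresentation.toSubmodule h]
      exact Submodule.mem_top
    exact hq ((Submodule.mem_bot k).1 hq')
  refine ⟨fun S => ?_⟩
  -- the preimage of `S` in `X`
  let N : Submodule k (Induced k K M) := S.toSubmodule.comap (maxSub k K M hfin).mkQ
  have hN : ∀ (g : G) ⦃x : Induced k K M⦄, x ∈ N → inducedRep k K M g x ∈ N := by
    intro g x hx
    simp only [N, Submodule.mem_comap] at hx ⊢
    rw [mkQ_equivariant (inducedRep k K M) (maxSub k K M hfin) (maxSub_stable k K M hfin)]
    exact S.apply_mem_toSubmodule g hx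
  have hinj : Function.Injective (Submodule.comap (maxSub k K M hfin).mkQ) :=
    Submodule.comap_injective_of_surjective (Submodule.mkQ_surjective _)
  by_cases hle : N ≤ maxSub k K M hfin
  · left
    apply Subrepresentation.ext
    apply hinj
    show N = Submodule.comap (maxSub k K M hfin).mkQ (⊥ : Subrepresentation (quotRep k K M hfin)).toSubmodule
    rw [show (⊥ : Subrepresentation (quotRep k K M hfin)).toSubmodule = ⊥ from rfl,
      Submodule.comap_bot, Submodule.ker_mkQ]
    exact le_antisymm hle (fun x hx => by
      simp only [N, Submodule.mem_comap, Submodule.mkQ_apply, (Submodule.Quotient.mk_eq_zero _).2 hx]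
      exact S.toSubmodule.zero_mem)
  · right
    apply Subrepresentation.ext
    apply hinj
    show N = Submodule.comap (maxSub k K M hfin).mkQ (⊤ : Subrepresentation (quotRep k K M hfin)).toSubmodule
    rw [show (⊤ : Subrepresentation (quotRep k K M hfin)).toSubmodule = ⊤ from rfl,
      Submodule.comap_top]
    exact eq_top_of_not_le k K M hfin hN hle

/-- `m ↦ [[m ⊗ δ_K]]` into `π^K`. -/
noncomputable def toQuot : M →ₗ[k] invariants (quotRep k K M hfin) K :=
  (invariantsMap (maxSub k K M hfin).mkQ
    (mkQ_equivariant (inducedRep k K M) (maxSub k K M hfin) (maxSub_stable k K M hfin)) K) ∘ₗ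
    (invariantsEquiv k K M hfin).toLinearMap

/-- The value of `toQuot`. -/
theorem toQuot_apply (m : M) :
    (toQuot k K M hfin m : Induced k K M ⧸ maxSub k K M hfin) =
      Submodule.Quotient.mk (toInduced k K M m) := by
  rw [toQuot, LinearMap.comp_apply, LinearEquiv.coe_coe, invariantsMap_apply, invariantsEquiv_apply,
    Submodule.mkQ_apply]

/-- `toQuot` is injective. -/
theorem toQuot_injective : Function.Injective (toQuot k K M hfin) := by
  intro m₁ m₂ h
  have h' := congrArg Subtype.val h
  rw [toQuot_apply, toQuot_apply, Submodule.Quotient.eq, ← map_sub] at h'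
  have h'' := eq_zero_of_mem_maxSub_of_mem_invariants k K M hfin h'
    (toInduced_mem_invariants k K M (m₁ - m₂))
  rw [map_sub, sub_eq_zero] at h''
  exact toInduced_injective k K M hfin h''

/-- `toQuot` is surjective (exactness of `V ↦ V^K`). -/
theorem toQuot_surjective : Function.Surjective (toQuot k K M hfin) := by
  intro y
  obtain ⟨x, hx⟩ := invariantsMap_surjective
    (mkQ_equivariant (inducedRep k K M) (maxSub k K M hfin) (maxSub_stable k K M hfin))
    (kFinite_inducedRep k K M hfin) (Submodule.mkQ_surjective _) y
  obtain ⟨m, hm⟩ := exists_toInduced_eq k K M hfin x.2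
  refine ⟨m, ?_⟩
  apply Subtype.ext
  rw [toQuot_apply, ← hx, invariantsMap_apply, Submodule.mkQ_apply, hm]

/-- `M ≃ π^K` as `k`-vector spaces. -/
noncomputable def quotInvariantsEquiv : M ≃ₗ[k] invariants (quotRep k K M hfin) K :=
  LinearEquiv.ofBijective (toQuot k K M hfin) ⟨toQuot_injective k K M hfin, toQuot_surjective k K M hfin⟩

/-- `M ≃ π^K` IS `H(G, K)`-LINEAR: the Hecke action on `π^K` is the module structure of `M`. -/
theorem heckeSMul_quotInvariantsEquiv (T : heckeAlgebra k K) (m : M) :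
    heckeSMul (quotRep k K M hfin) T (quotInvariantsEquiv k K M hfin m) =
      quotInvariantsEquiv k K M hfin (MulOpposite.op T • m) := by
  show heckeSMul (quotRep k K M hfin) T (toQuot k K M hfin m) = toQuot k K M hfin (MulOpposite.op T • m)
  rw [toQuot, LinearMap.comp_apply, LinearMap.comp_apply, LinearEquiv.coe_coe,
    ← invariantsMap_heckeSMul, heckeSMul_invariantsEquiv]

/-- EVERY SIMPLE `H(G, K)`-MODULE IS `π^K` FOR AN IRREDUCIBLE `K`-FINITE `π` — the surjectivity
half of «irreducible `π` with `π^K ≠ 0` ↔ simple `H(G, K)`-modules», packaged: the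
representation `quotRep` is irreducible and `K`-finite, and `M ≃ π^K` `H(G, K)`-linearly. -/
theorem isIrreducible_and_kFinite_and_equiv [IsSimpleOrder (Submodule (heckeAlgebra k K)ᵐᵒᵖ M)] :
    (quotRep k K M hfin).IsIrreducible ∧ KFinite (quotRep k K M hfin) K ∧
      ∃ e : M ≃ₗ[k] invariants (quotRep k K M hfin) K,
        ∀ (T : heckeAlgebra k K) (m : M),
          heckeSMul (quotRep k K M hfin) T (e m) = e (MulOpposite.op T • m) :=
  ⟨isIrreducible_quotRep k K M hfin, kFinite_quotRep k K M hfin,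
    ⟨quotInvariantsEquiv k K M hfin, heckeSMul_quotInvariantsEquiv k K M hfin⟩⟩

end Main

end Summit.Ventures.HodgeRepro2.T5HeckeInducedIrreducible
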